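import Summits.NavierStokesRegularity.FluidComputer.DampedTransition

/-!
# Tao's delay gate under NON-UNIFORM diagonal damping, part 9: INPUT FRAGILITY — the gate misfires
# on a clock-mode perturbation of size `10ε`

Companion of `DampedTransition*.lean` (cell `pub-fluidc`, seat bp1). HONEST FRAMING (verbatim): low prior, high
value-of-information experiment on Tao's machine paradigm; NOT a claim that NS blows up. Five-mode truncation (5.5)
of [Tao2016AveragedNS, §5.5] with a diagonal damping `-E(t) * X`, `0 ≤ Eᵢ(t) ≤ η`; nothing about Navier–Stokes.

The NEGATIVE companion of THE DAMPED GATE THEOREM (`DampedTransition.firingPhase`, part 7), answering the hand-off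
question "does the gate tolerate an imperfect input?" for the CLOCK mode `b = X 1`: NO, not even remotely at the
accuracy `200K⁻¹⁰` at which an upstream gate delivers its output. If the input is `(a, β, 0, d₀, ã₀)` with
`β ≤ -10ε` (any energy `≤ 2`, any damping `η ≤ 1/4`), then on the WHOLE horizon `[0,2]` the clock runs backwards
(`b < 0`) and the trigger never reaches its critical level: `0 ≤ c ≤ 4ε²e^{-M} < ε²K⁻¹⁰` (`misfire_of_negative_clock`,
`misfire_below_threshold`, and `misfire_family` under exactly the family hypotheses of `firingPhase`). Contrast: from
`delayInit` the trigger hits `ε²K⁻¹⁰` at `t_c ≈ √2` and exceeds `K¹⁰⁰ε²` from `t_c + 888 log K/M` on. Since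
`ε ≤ e^{-10M}K⁻¹⁰⁰ ⋘ K⁻¹⁰`, a cascade of such gates cannot be assembled from the gate theorem by feeding each
output box into the next input UNLESS the fresh clock/trigger modes of the next stage are EXACTLY unexcited (as in
print's design, where they are new Fourier modes) — the typed form of the HAND-OFF AUDIT caveat of bp3's
`TubeStage.handOff_fresh_modes`. Mechanism: with `b ≤ 0` the amplifier `ε⁻¹Mbc` has the wrong sign, so
`ċ ≤ ε²e^{-M}a² ≤ 2ε²e^{-M}`, and `ḃ ≤ εa² + η|b| ≤ 2ε + |b|/4` cannot lift `b` from `-10ε` to `0` within time `2`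
(a two-sided continuous induction). [cite: Tao2016AveragedNS, §5.5 (5.5); §6.1]. No named facts; 0 sorry.
-/

noncomputable section

namespace Summit.NavierStokesRegularity.FluidComputer

open Real Set Filter Topology
open Literature.Analysis.FluidPDE.Tao2016AveragedNS
open Literature.Analysis.FluidPDE.Tao2016AveragedNS.Thm53 (antitoneOn_sub_of_deriv_le monotoneOn_sub_of_le_deriv)
open Literature.Analysis.FluidPDE.Tao2016AveragedNS.Thm53With (family_params eps_facts)

namespace DampedTransition

section Misfire

variable {K M ε η : ℝ} {E X : ℝ → Fin 5 → ℝ}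

/-- Energy bound from an input of energy `≤ 2`: `Xᵢ(t)² ≤ 2` on `[0,2]` (energy is non-increasing under
non-negative damping). [folklore] -/
theorem traj_sq_le_two
    (hX : ∀ t ∈ Icc (0:ℝ) 2, HasDerivAt X (delayCircuitWith K M ε (X t) - E t * X t) t)
    (hE : ∀ t ∈ Icc (0:ℝ) 2, ∀ i, 0 ≤ E t i ∧ E t i ≤ η) (hEn : energy (X 0) ≤ 2) {t : ℝ}
    (ht : t ∈ Icc (0:ℝ) 2) (i : Fin 5) : X t i ^ 2 ≤ 2 := by
  have h := energy_antitoneOn_damped (isCancelling_delayCircuitWith K M ε) (convex_Icc 0 2) hX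
    (fun t ht i => (hE t ht i).1) ⟨le_rfl, zero_le_two⟩ ht ht.1
  have h2 : energy (X t) ≤ 2 := h.trans hEn
  rw [energy] at h2
  exact le_trans (Finset.single_le_sum (f := fun j => X t j ^ 2) (fun j _ => sq_nonneg (X t j))
    (Finset.mem_univ i)) h2

/-- **The bootstrap step.** If `b ≤ 0` on `[0,τ]` (`τ ≤ 2`), input `b(0) ≤ -10ε`, `c(0) = 0`, energy `≤ 2`,
damping `η ≤ 1/4`, and `64Mε²e^{-2M} ≤ 1`, then on `[0,τ]`: `b < 0` STRICTLY (indeed `b ≤ b(0)/2 + 17ε/4`),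
`0 ≤ c ≤ 2ε²e^{-M}·t`. [cite: Tao2016AveragedNS, §5.5 (5.5)] -/
theorem misfire_aux
    (hX : ∀ t ∈ Icc (0:ℝ) 2, HasDerivAt X (delayCircuitWith K M ε (X t) - E t * X t) t)
    (hE : ∀ t ∈ Icc (0:ℝ) 2, ∀ i, 0 ≤ E t i ∧ E t i ≤ η) (hη : η ≤ 1 / 4) (hEn : energy (X 0) ≤ 2)
    (hb0 : X 0 1 ≤ -(10 * ε)) (hc0 : X 0 2 = 0) (hε : 0 < ε) (hM0 : 0 ≤ M)
    (hMε : 64 * M * ε ^ 2 * exp (-M) ^ 2 ≤ 1) {τ : ℝ} (hτ2 : τ ≤ 2)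
    (hb : ∀ t ∈ Icc 0 τ, X t 1 ≤ 0) {t : ℝ} (ht : t ∈ Icc 0 τ) :
    X t 1 < 0 ∧ 0 ≤ X t 2 ∧ X t 2 ≤ 2 * ε ^ 2 * exp (-M) * t := by
  have hI : ∀ s ∈ Icc 0 τ, s ∈ Icc (0:ℝ) 2 := fun s hs => ⟨hs.1, hs.2.trans hτ2⟩
  -- Step 1: `c ≥ 0` on `[0,τ]` (barrier: when `c < 0` and `b ≤ 0` every term of `ċ` is `≥ 0`)
  have hc : ∀ s ∈ Icc 0 τ, 0 ≤ X s 2 := by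
    intro s hs
    refine nonneg_of_deriv_barrier (L := 0) (a := 0) (b := τ) le_rfl
      (fun r hr => hasDerivAt_c (hX r (hI r hr))) (by rw [hc0]) (fun r hr hcr => ?_) hs
    have hbr : X r 1 ≤ 0 := hb r ⟨hr.1, hr.2.le⟩
    have h1 : 0 ≤ ε⁻¹ * M * X r 1 * X r 2 := by
      rw [mul_assoc (ε⁻¹ * M)]
      exact mul_nonneg (by positivity) (mul_nonneg_of_nonpos_of_nonpos hbr hcr.le)
    have h2 : 0 ≤ -(E r 2 * X r 2) := by
      rw [neg_nonneg]
      exact mul_nonpos_of_nonneg_of_nonpos (hE r (hI r ⟨hr.1, hr.2.le⟩) 2).1 hcr.le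
    have h3 : 0 ≤ ε ^ 2 * exp (-M) * X r 0 ^ 2 := by positivity
    rw [zero_mul]; linarith
  -- Step 2: `ċ ≤ 2ε²e^{-M}` on `[0,τ]`, hence `c ≤ 2ε²e^{-M} t`
  have hcD : ∀ r ∈ Icc 0 τ,
      ε ^ 2 * exp (-M) * X r 0 ^ 2 + ε⁻¹ * M * X r 1 * X r 2 - E r 2 * X r 2 ≤ 2 * ε ^ 2 * exp (-M) := by
    intro r hr
    have ha2 : X r 0 ^ 2 ≤ 2 := traj_sq_le_two hX hE hEn (hI r hr) 0
    have h1 : ε⁻¹ * M * X r 1 * X r 2 ≤ 0 := by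
      rw [mul_assoc (ε⁻¹ * M)]
      exact mul_nonpos_of_nonneg_of_nonpos (by positivity)
        (mul_nonpos_of_nonpos_of_nonneg (hb r hr) (hc r hr))
    have h2 : -(E r 2 * X r 2) ≤ 0 := by
      rw [neg_nonpos]; exact mul_nonneg (hE r (hI r hr) 2).1 (hc r hr)
    have h3 : ε ^ 2 * exp (-M) * X r 0 ^ 2 ≤ ε ^ 2 * exp (-M) * 2 :=
      mul_le_mul_of_nonneg_left ha2 (by positivity)
    linarith
  have hcu : ∀ s ∈ Icc 0 τ, X s 2 ≤ 2 * ε ^ 2 * exp (-M) * s := by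
    have hanti := antitoneOn_sub_of_deriv_le (f := fun s => X s 2)
      (f' := fun r => ε ^ 2 * exp (-M) * X r 0 ^ 2 + ε⁻¹ * M * X r 1 * X r 2 - E r 2 * X r 2)
      (Φ := fun s => 2 * ε ^ 2 * exp (-M) * s) (φ := fun _ => 2 * ε ^ 2 * exp (-M))
      (convex_Icc 0 τ) (fun r hr => hasDerivAt_c (hX r (hI r hr)))
      (fun r _ => by simpa using (hasDerivAt_id r).const_mul (2 * ε ^ 2 * exp (-M))) hcD
    intro s hs
    have h := hanti ⟨le_rfl, hs.1.trans hs.2⟩ hs hs.1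
    simp only [hc0, mul_zero, sub_zero] at h
    linarith
  -- Step 3: `ḃ ≥ -16Mε³e^{-2M}` on `[0,τ]`, hence `b ≥ b(0) - ε/2`
  have hbDl : ∀ r ∈ Icc 0 τ,
      -(16 * M * ε ^ 3 * exp (-M) ^ 2) ≤ ε * X r 0 ^ 2 - ε⁻¹ * M * X r 2 ^ 2 - E r 1 * X r 1 := by
    intro r hr
    have hcr : 0 ≤ X r 2 := hc r hr
    have hc4 : X r 2 ≤ 4 * ε ^ 2 * exp (-M) := by
      have h := hcu r hr
      have : 2 * ε ^ 2 * exp (-M) * r ≤ 2 * ε ^ 2 * exp (-M) * 2 :=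
        mul_le_mul_of_nonneg_left (hr.2.trans hτ2) (by positivity)
      linarith
    have hc2 : X r 2 ^ 2 ≤ (4 * ε ^ 2 * exp (-M)) ^ 2 := pow_le_pow_left₀ hcr hc4 2
    have h1 : ε⁻¹ * M * X r 2 ^ 2 ≤ 16 * M * ε ^ 3 * exp (-M) ^ 2 := by
      calc ε⁻¹ * M * X r 2 ^ 2 ≤ ε⁻¹ * M * (4 * ε ^ 2 * exp (-M)) ^ 2 :=
            mul_le_mul_of_nonneg_left hc2 (by positivity)
        _ = 16 * M * ε ^ 3 * exp (-M) ^ 2 := by field_simp; ring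
    have h2 : E r 1 * X r 1 ≤ 0 := mul_nonpos_of_nonneg_of_nonpos (hE r (hI r hr) 1).1 (hb r hr)
    have h3 : 0 ≤ ε * X r 0 ^ 2 := by positivity
    linarith
  have hbl : ∀ s ∈ Icc 0 τ, X 0 1 - ε / 2 ≤ X s 1 := by
    have hmono := monotoneOn_sub_of_le_deriv (f := fun s => X s 1)
      (f' := fun r => ε * X r 0 ^ 2 - ε⁻¹ * M * X r 2 ^ 2 - E r 1 * X r 1)
      (Φ := fun s => -(16 * M * ε ^ 3 * exp (-M) ^ 2) * s)
      (φ := fun _ => -(16 * M * ε ^ 3 * exp (-M) ^ 2))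
      (convex_Icc 0 τ) (fun r hr => hasDerivAt_b (hX r (hI r hr)))
      (fun r _ => by simpa using (hasDerivAt_id r).const_mul (-(16 * M * ε ^ 3 * exp (-M) ^ 2)))
      hbDl
    intro s hs
    have h := hmono ⟨le_rfl, hs.1.trans hs.2⟩ hs hs.1
    simp only [mul_zero, sub_zero] at h
    have hs2 : s ≤ 2 := hs.2.trans hτ2
    have h16 : 16 * M * ε ^ 3 * exp (-M) ^ 2 * s ≤ 16 * M * ε ^ 3 * exp (-M) ^ 2 * 2 :=
      mul_le_mul_of_nonneg_left hs2 (by positivity)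
    have h32 : 16 * M * ε ^ 3 * exp (-M) ^ 2 * 2 ≤ ε / 2 := by
      have : 16 * M * ε ^ 3 * exp (-M) ^ 2 * 2 = ε / 2 * (64 * M * ε ^ 2 * exp (-M) ^ 2) := by ring
      rw [this]
      exact (mul_le_mul_of_nonneg_left hMε (by positivity)).trans (by linarith)
    linarith
  -- Step 4: `ḃ ≤ 2ε + ε/8 + |b(0)|/4` on `[0,τ]`, hence `b ≤ b(0)/2 + 17ε/4 < 0`
  have hbDu : ∀ r ∈ Icc 0 τ,
      ε * X r 0 ^ 2 - ε⁻¹ * M * X r 2 ^ 2 - E r 1 * X r 1 ≤ 2 * ε + ε / 8 + -(X 0 1) / 4 := by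
    intro r hr
    have ha2 : X r 0 ^ 2 ≤ 2 := traj_sq_le_two hX hE hEn (hI r hr) 0
    have h1 : ε * X r 0 ^ 2 ≤ ε * 2 := mul_le_mul_of_nonneg_left ha2 hε.le
    have h2 : 0 ≤ ε⁻¹ * M * X r 2 ^ 2 := by positivity
    have hE1 := hE r (hI r hr) 1
    have hnn : 0 ≤ -(X r 1) := by linarith [hb r hr]
    have h3 : -(E r 1 * X r 1) ≤ η * (-(X r 1)) := by
      have := mul_le_mul_of_nonneg_right hE1.2 hnn
      linarith
    have h4 : η * (-(X r 1)) ≤ 1 / 4 * (-(X 0 1) + ε / 2) :=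
      calc η * (-(X r 1)) ≤ 1 / 4 * (-(X r 1)) := mul_le_mul_of_nonneg_right hη hnn
        _ ≤ 1 / 4 * (-(X 0 1) + ε / 2) :=
            mul_le_mul_of_nonneg_left (by linarith [hbl r hr]) (by norm_num)
    linarith
  have hbu : ∀ s ∈ Icc 0 τ, X s 1 ≤ X 0 1 + (2 * ε + ε / 8 + -(X 0 1) / 4) * s := by
    have hanti := antitoneOn_sub_of_deriv_le (f := fun s => X s 1)
      (f' := fun r => ε * X r 0 ^ 2 - ε⁻¹ * M * X r 2 ^ 2 - E r 1 * X r 1)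
      (Φ := fun s => (2 * ε + ε / 8 + -(X 0 1) / 4) * s)
      (φ := fun _ => 2 * ε + ε / 8 + -(X 0 1) / 4)
      (convex_Icc 0 τ) (fun r hr => hasDerivAt_b (hX r (hI r hr)))
      (fun r _ => by simpa using (hasDerivAt_id r).const_mul (2 * ε + ε / 8 + -(X 0 1) / 4)) hbDu
    intro s hs
    have h := hanti ⟨le_rfl, hs.1.trans hs.2⟩ hs hs.1
    simp only [mul_zero, sub_zero] at h
    linarith
  have hblt : X t 1 < 0 := by
    have h := hbu t ht
    have hC0 : 0 ≤ 2 * ε + ε / 8 + -(X 0 1) / 4 := by linarith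
    have hCt : (2 * ε + ε / 8 + -(X 0 1) / 4) * t ≤ (2 * ε + ε / 8 + -(X 0 1) / 4) * 2 :=
      mul_le_mul_of_nonneg_left (ht.2.trans hτ2) hC0
    linarith
  exact ⟨hblt, hc t ht, hcu t ht⟩

/-- **INPUT FRAGILITY OF THE CLOCK MODE (the gate misfires).** Let `X` solve the damped delay circuit on `[0,2]`
with ANY damping `0 ≤ Eᵢ(t) ≤ η ≤ 1/4`, from an input with energy `≤ 2`, trigger `c(0) = 0` and clock
`b(0) ≤ -10ε` (e.g. `delayInit - 10ε·e₁`: a perturbation of size `10ε ≤ 10e^{-10M}K⁻¹⁰⁰`, astronomically below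
the output accuracy `200K⁻¹⁰` of an upstream gate), and let `64Mε²e^{-2M} ≤ 1`. Then for ALL `t ∈ [0,2]`:
`b(t) < 0` and `0 ≤ c(t) ≤ 4ε²e^{-M}` — the trigger never grows. [cite: Tao2016AveragedNS, §5.5 (5.5); §6.1] -/
theorem misfire_of_negative_clock
    (hX : ∀ t ∈ Icc (0:ℝ) 2, HasDerivAt X (delayCircuitWith K M ε (X t) - E t * X t) t)
    (hE : ∀ t ∈ Icc (0:ℝ) 2, ∀ i, 0 ≤ E t i ∧ E t i ≤ η) (hη : η ≤ 1 / 4) (hEn : energy (X 0) ≤ 2)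
    (hb0 : X 0 1 ≤ -(10 * ε)) (hc0 : X 0 2 = 0) (hε : 0 < ε) (hM0 : 0 ≤ M)
    (hMε : 64 * M * ε ^ 2 * exp (-M) ^ 2 ≤ 1) {t : ℝ} (ht : t ∈ Icc (0:ℝ) 2) :
    X t 1 < 0 ∧ 0 ≤ X t 2 ∧ X t 2 ≤ 4 * ε ^ 2 * exp (-M) := by
  have hlt : X 0 1 < 0 := by linarith
  obtain ⟨τ, hτ0, hτ2, hle, heq⟩ :=
    exists_hitTime_on (θ := 0) two_pos (continuousOn_traj hX 1) hlt
  have hb : ∀ s ∈ Icc 0 τ, X s 1 ≤ 0 := fun s hs => hle s hs.1 hs.2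
  have haux : ∀ s ∈ Icc 0 τ, X s 1 < 0 ∧ 0 ≤ X s 2 ∧ X s 2 ≤ 2 * ε ^ 2 * exp (-M) * s :=
    fun s hs => misfire_aux hX hE hη hEn hb0 hc0 hε hM0 hMε hτ2 hb hs
  have hτ : τ = 2 := by
    by_contra hne
    have h0 : X τ 1 = 0 := heq (lt_of_le_of_ne hτ2 hne)
    have h1 : X τ 1 < 0 := (haux τ ⟨hτ0.le, le_rfl⟩).1
    linarith
  subst hτ
  obtain ⟨h1, h2, h3⟩ := haux t ht
  refine ⟨h1, h2, h3.trans ?_⟩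
  have : 2 * ε ^ 2 * exp (-M) * t ≤ 2 * ε ^ 2 * exp (-M) * 2 :=
    mul_le_mul_of_nonneg_left ht.2 (by positivity)
  linarith

/-- **… and the trigger stays BELOW ITS CRITICAL LEVEL `ε²K⁻¹⁰` on the whole horizon** (`8K¹⁰e^{-M} ≤ 1`):
no critical time `t_c` exists in `[0,2]`. [cite: Tao2016AveragedNS, §5.5 (5.5); §6.1] -/
theorem misfire_below_threshold
    (hX : ∀ t ∈ Icc (0:ℝ) 2, HasDerivAt X (delayCircuitWith K M ε (X t) - E t * X t) t)
    (hE : ∀ t ∈ Icc (0:ℝ) 2, ∀ i, 0 ≤ E t i ∧ E t i ≤ η) (hη : η ≤ 1 / 4) (hEn : energy (X 0) ≤ 2)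
    (hb0 : X 0 1 ≤ -(10 * ε)) (hc0 : X 0 2 = 0) (hε : 0 < ε) (hM0 : 0 ≤ M)
    (hMε : 64 * M * ε ^ 2 * exp (-M) ^ 2 ≤ 1) (hK0 : 0 < K) (hKM : 8 * K ^ 10 * exp (-M) ≤ 1)
    {t : ℝ} (ht : t ∈ Icc (0:ℝ) 2) : X t 1 < 0 ∧ 0 ≤ X t 2 ∧ X t 2 < ε ^ 2 / K ^ 10 := by
  obtain ⟨h1, h2, h3⟩ := misfire_of_negative_clock hX hE hη hEn hb0 hc0 hε hM0 hMε ht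
  refine ⟨h1, h2, ?_⟩
  have hK10 : 0 < K ^ 10 := by positivity
  rw [lt_div_iff₀ hK10]
  calc X t 2 * K ^ 10 ≤ 4 * ε ^ 2 * exp (-M) * K ^ 10 := mul_le_mul_of_nonneg_right h3 hK10.le
    _ = ε ^ 2 / 2 * (8 * K ^ 10 * exp (-M)) := by ring
    _ ≤ ε ^ 2 / 2 * 1 := mul_le_mul_of_nonneg_left hKM (by positivity)
    _ < ε ^ 2 := by nlinarith [pow_pos hε 2]

/-- **THE MISFIRE UNDER THE FAMILY OF THE GATE THEOREM.** Same `K, M, ε` as `DampedTransition.firingPhase`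
(`K ≥ 2·20⁴²·42! + 16`, `3000 log K ≤ M ≤ K¹⁰`, `0 < ε ≤ e^{-10M}/K¹⁰⁰`), any damping `0 ≤ Eᵢ ≤ η ≤ 1/4`, input
`X(0) = (1, β, 0, 0, 0)` with `-1 ≤ β ≤ -10ε`: for all `t ∈ [0,2]`, `b(t) < 0` and `0 ≤ c(t) < ε²K⁻¹⁰` — whereas
from `β = 0` (`delayInit`) the gate fires at `t_c ≈ √2` (`firingPhase`). The gate theorem therefore does NOT
chain through its own output box; a cascade needs the next stage's clock/trigger modes EXACTLY unexcited.
HONEST FRAMING: a statement about a five-mode ODE; low prior, high value-of-information experiment on Tao's machine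
paradigm; NOT a claim that NS blows up. [cite: Tao2016AveragedNS, §5.5 Theorem 5.3; §6.1] -/
theorem misfire_family {β : ℝ}
    (hX : ∀ t ∈ Icc (0:ℝ) 2, HasDerivAt X (delayCircuitWith K M ε (X t) - E t * X t) t)
    (hE : ∀ t ∈ Icc (0:ℝ) 2, ∀ i, 0 ≤ E t i ∧ E t i ≤ η) (hη : η ≤ 1 / 4)
    (h00 : X 0 0 = 1) (h01 : X 0 1 = β) (h02 : X 0 2 = 0) (h03 : X 0 3 = 0) (h04 : X 0 4 = 0)
    (hβ1 : -1 ≤ β) (hβ : β ≤ -(10 * ε))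
    (hK : 2 * 20 ^ 42 * (Nat.factorial 42 : ℝ) + 16 ≤ K) (hML : 3000 * Real.log K ≤ M)
    (hMK : M ≤ K ^ 10) (hε : 0 < ε) (hεle : ε ≤ exp (-(10 * M)) / K ^ 100)
    {t : ℝ} (ht : t ∈ Icc (0:ℝ) 2) : X t 1 < 0 ∧ 0 ≤ X t 2 ∧ X t 2 < ε ^ 2 / K ^ 10 := by
  obtain ⟨hK16, hM0, -, hlog2, -⟩ := family_params hK hML
  obtain ⟨hε1, hεK, hε100, -⟩ := eps_facts hK16 hM0 hMK hε hεle
  have hK0 : 0 < K := by linarith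
  have hK1 : (1:ℝ) ≤ K := by linarith
  -- energy of the input: `1 + β² ≤ 2`
  have hEn : energy (X 0) ≤ 2 := by
    have hβsq : β ^ 2 ≤ 1 := by nlinarith
    simp only [energy, Fin.sum_univ_five, h00, h01, h02, h03, h04]
    nlinarith
  -- `e^{-M} ≤ K^{-3000}`
  have hexpM : exp (-M) * K ^ 3000 ≤ 1 := by
    have h1 : K ^ 3000 = exp ((3000 : ℕ) * Real.log K) := by
      rw [Real.exp_nat_mul, Real.exp_log hK0]
    have h2 : exp ((3000 : ℕ) * Real.log K) ≤ exp M := by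
      rw [exp_le_exp]; push_cast; linarith
    calc exp (-M) * K ^ 3000 ≤ exp (-M) * exp M :=
          mul_le_mul_of_nonneg_left (h1 ▸ h2) (exp_pos _).le
      _ = 1 := by rw [← Real.exp_add]; simp
  have hKM : 8 * K ^ 10 * exp (-M) ≤ 1 := by
    have h8 : (8:ℝ) * K ^ 10 ≤ K ^ 3000 := by
      calc (8:ℝ) * K ^ 10 ≤ K * K ^ 10 := mul_le_mul_of_nonneg_right (by linarith) (by positivity)
        _ = K ^ 11 := by ring
        _ ≤ K ^ 3000 := pow_le_pow_right₀ hK1 (by norm_num)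
    calc 8 * K ^ 10 * exp (-M) ≤ K ^ 3000 * exp (-M) :=
          mul_le_mul_of_nonneg_right h8 (exp_pos _).le
      _ = exp (-M) * K ^ 3000 := by ring
      _ ≤ 1 := hexpM
  have hMε : 64 * M * ε ^ 2 * exp (-M) ^ 2 ≤ 1 := by
    have he1 : exp (-M) ≤ 1 := by rw [exp_le_one_iff, neg_nonpos]; exact hM0.le
    have he2 : exp (-M) ^ 2 ≤ 1 := pow_le_one₀ (exp_pos _).le he1
    have h64 : 64 * M * ε ^ 2 ≤ 1 := by
      -- `ε² ≤ 1/(6K²⁰)` and `M ≤ K¹⁰`, `K ≥ 16`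
      have h1 : 64 * M * ε ^ 2 ≤ 64 * K ^ 10 * (1 / (6 * K ^ 20)) := by
        have := mul_le_mul (mul_le_mul_of_nonneg_left hMK (by norm_num : (0:ℝ) ≤ 64)) hεK
          (by positivity) (by positivity)
        linarith
      have h2 : 64 * K ^ 10 * (1 / (6 * K ^ 20)) ≤ 1 := by
        rw [mul_one_div, div_le_one (by positivity)]
        have : (64:ℝ) ≤ 6 * K ^ 10 := by
          have := pow_le_pow_left₀ (by norm_num : (0:ℝ) ≤ 16) hK16 10
          nlinarith
        nlinarith [pow_pos hK0 10]
      linarith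
    calc 64 * M * ε ^ 2 * exp (-M) ^ 2 ≤ 64 * M * ε ^ 2 * 1 :=
          mul_le_mul_of_nonneg_left he2 (by positivity)
      _ ≤ 1 := by linarith
  have hb0 : X 0 1 ≤ -(10 * ε) := by rw [h01]; exact hβ
  exact misfire_below_threshold hX hE hη hEn hb0 h02 hε hM0.le hMε hK0 hKM ht

end Misfire

end DampedTransition

end Summit.NavierStokesRegularity.FluidComputer
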